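import Mathlib

/-!
# Tate cohomology of an involution in degrees `0` and `−1`: the comparison with a finite quotient

`B` a commutative group with an involutive endomorphism `σ` (think `Gal(E/F) = {1, σ}` acting on
`E^×` or on a subgroup of it).  The two Tate groups of the cyclic group `{1, σ}` are
`Ĥ⁰ = B^σ / N B` and `Ĥ⁻¹ = ker N / D B`, with `N b = b · σ b` (`normHom`) and `D b = b · (σ b)⁻¹`
(`diffHom`); we only record their ORDERS as relative indices:
`h⁰ = (range N).relIndex (ker D)`, `h⁻¹ = (range D).relIndex (ker N)`.

* `relIndex_eq_of_finite`: for FINITE `B` the two orders agree (`h⁰ = h⁻¹`, i.e. the Herbrand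
  quotient of a finite module is `1`): `|ker D| · |range D| = |B| = |ker N| · |range N|`.
* `relIndex_eq_of_subgroup`: if `V ≤ B` is a `σ`-stable subgroup of FINITE INDEX which is
  cohomologically trivial in degrees `0` and `−1` (every `σ`-fixed element of `V` is a norm from
  `V`; every norm-one element of `V` is `c / σ c` with `c ∈ V`), then again `h⁰(B) = h⁻¹(B)` — the
  two groups are those of the finite quotient `B / V` (the six-term exact sequence with the
  vanishing terms removed, done by hand: `relIndex_map_eq_of_inf_ker_le`).
* `relIndex_eq_of_subgroup_of_le`: the same for a `σ`-stable subgroup `U ≤ B` containing such a `V`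
  (the form used for the units of a local field inside its multiplicative group).

This is the Herbrand-quotient step of the local norm index theorem (Serre, *Local Fields*,
Ch. V §3 / Ch. VIII §2) in the only case needed: the cyclic group of order `2`.

Declaration per README §8(d): «uses an L-value-free non-vanishing device: NO».
-/

namespace Summit.Ventures.HodgeRepro2.T5TateComparison

variable {B : Type*} [CommGroup B] (σ : B →* B)

/-- The norm `N b = b · σ b`. -/
def normHom : B →* B where
  toFun b := b * σ b
  map_one' := by simp
  map_mul' a b := by rw [map_mul, mul_mul_mul_comm]

/-- The «difference» `D b = b · (σ b)⁻¹`. -/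
def diffHom : B →* B where
  toFun b := b * (σ b)⁻¹
  map_one' := by simp
  map_mul' a b := by rw [map_mul, mul_inv, mul_mul_mul_comm]

/-- `N b = b · σ b`. -/
@[simp] theorem normHom_apply (b : B) : normHom σ b = b * σ b := rfl

/-- `D b = b · (σ b)⁻¹`. -/
@[simp] theorem diffHom_apply (b : B) : diffHom σ b = b * (σ b)⁻¹ := rfl

/-- `b ∈ ker D ↔ σ b = b`. -/
theorem mem_ker_diffHom {b : B} : b ∈ (diffHom σ).ker ↔ σ b = b := by
  rw [MonoidHom.mem_ker, diffHom_apply, mul_inv_eq_one, eq_comm]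

/-- `b ∈ ker N ↔ b · σ b = 1`. -/
theorem mem_ker_normHom {b : B} : b ∈ (normHom σ).ker ↔ b * σ b = 1 := Iff.rfl

variable (hσσ : ∀ b, σ (σ b) = b)

include hσσ in
/-- Norms are `σ`-fixed. -/
theorem apply_normHom (b : B) : σ (normHom σ b) = normHom σ b := by
  simp only [normHom_apply, map_mul, hσσ, mul_comm]

include hσσ in
/-- `N (D b) = 1`. -/
theorem normHom_diffHom (b : B) : normHom σ (diffHom σ b) = 1 := by
  simp only [normHom_apply, diffHom_apply, map_mul, map_inv, hσσ]
  rw [mul_comm (σ b) b, mul_inv_cancel]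

include hσσ in
/-- `range N ≤ ker D`. -/
theorem range_normHom_le : (normHom σ).range ≤ (diffHom σ).ker := by
  rintro _ ⟨b, rfl⟩
  exact (mem_ker_diffHom σ).mpr (apply_normHom σ hσσ b)

include hσσ in
/-- `range D ≤ ker N`. -/
theorem range_diffHom_le : (diffHom σ).range ≤ (normHom σ).ker := by
  rintro _ ⟨b, rfl⟩
  exact normHom_diffHom σ hσσ b

include hσσ in
/-- THE HERBRAND QUOTIENT OF A FINITE MODULE IS `1`: for finite `B`,
`(range N).relIndex (ker D) = (range D).relIndex (ker N)`. -/
theorem relIndex_eq_of_finite [Finite B] :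
    (normHom σ).range.relIndex (diffHom σ).ker = (diffHom σ).range.relIndex (normHom σ).ker := by
  set a := (normHom σ).range.relIndex (diffHom σ).ker with ha
  set b := (diffHom σ).range.relIndex (normHom σ).ker with hb
  have h1 : a * (diffHom σ).ker.index = (normHom σ).range.index :=
    Subgroup.relIndex_mul_index (range_normHom_le σ hσσ)
  have h2 : b * (normHom σ).ker.index = (diffHom σ).range.index :=
    Subgroup.relIndex_mul_index (range_diffHom_le σ hσσ)
  rw [Subgroup.index_ker] at h1 h2
  have h3 := Subgroup.index_mul_card (normHom σ).range
  have h4 := Subgroup.index_mul_card (diffHom σ).range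
  rw [← h1] at h3
  rw [← h2] at h4
  have hne : Nat.card (diffHom σ).range * Nat.card (normHom σ).range ≠ 0 :=
    Nat.mul_ne_zero Nat.card_pos.ne' Nat.card_pos.ne'
  apply Nat.eq_of_mul_eq_mul_right (Nat.pos_of_ne_zero hne)
  rw [← mul_assoc, h3, ← mul_assoc]
  rw [mul_right_comm] at h4
  rw [h4]

/-- Transport of a relative index along a quotient map: if `C ≤ A` and `A ⊓ ker p ≤ C` then
`(C.map p).relIndex (A.map p) = C.relIndex A`. -/
theorem relIndex_map_eq_of_inf_ker_le {Q : Type*} [Group Q] (p : B →* Q) (C A : Subgroup B)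
    (hCA : C ≤ A) (h : A ⊓ p.ker ≤ C) :
    (C.map p).relIndex (A.map p) = C.relIndex A := by
  rw [← Subgroup.relIndex_comap, Subgroup.comap_map_eq, ← Subgroup.inf_relIndex_right]
  congr 1
  apply le_antisymm
  · intro x hx
    rw [Subgroup.mem_inf, Subgroup.mem_sup] at hx
    obtain ⟨⟨c, hc, k, hk, rfl⟩, hxA⟩ := hx
    have hkA : k ∈ A := by
      have := A.mul_mem (A.inv_mem (hCA hc)) hxA
      rwa [inv_mul_cancel_left] at this
    have hkC : k ∈ C := h (Subgroup.mem_inf.mpr ⟨hkA, hk⟩)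
    exact C.mul_mem hc hkC
  · intro x hx
    exact Subgroup.mem_inf.mpr ⟨Subgroup.mem_sup_left hx, hCA hx⟩

section Quotient

variable (V : Subgroup B) (hV : ∀ b ∈ V, σ b ∈ V)

include hV in
/-- `V ≤ ker (mk' V ∘ σ)`: the involution descends to `B ⧸ V`. -/
theorem le_ker_comp : V ≤ ((QuotientGroup.mk' V).comp σ).ker := by
  intro b hb
  rw [MonoidHom.mem_ker, MonoidHom.comp_apply, ← MonoidHom.mem_ker, QuotientGroup.ker_mk']
  exact hV b hb

/-- The involution on the quotient `B ⧸ V`. -/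
noncomputable def quotientAut : B ⧸ V →* B ⧸ V :=
  QuotientGroup.lift V ((QuotientGroup.mk' V).comp σ) (le_ker_comp σ V hV)

/-- The descended involution on a class. -/
theorem quotientAut_mk (b : B) :
    quotientAut σ V hV (QuotientGroup.mk' V b) = QuotientGroup.mk' V (σ b) :=
  QuotientGroup.lift_mk' (N := V) (le_ker_comp σ V hV) b

include hσσ in
/-- The descended involution is an involution. -/
theorem quotientAut_quotientAut (q : B ⧸ V) : quotientAut σ V hV (quotientAut σ V hV q) = q := by
  induction q using QuotientGroup.induction_on with
  | H b =>
    change quotientAut σ V hV (quotientAut σ V hV (QuotientGroup.mk' V b)) = QuotientGroup.mk' V b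
    rw [quotientAut_mk, quotientAut_mk, hσσ]

/-- `N` commutes with the projection. -/
theorem normHom_quotientAut_mk (b : B) :
    normHom (quotientAut σ V hV) (QuotientGroup.mk' V b) = QuotientGroup.mk' V (normHom σ b) := by
  rw [normHom_apply, normHom_apply, map_mul, quotientAut_mk]

/-- `D` commutes with the projection. -/
theorem diffHom_quotientAut_mk (b : B) :
    diffHom (quotientAut σ V hV) (QuotientGroup.mk' V b) = QuotientGroup.mk' V (diffHom σ b) := by
  rw [diffHom_apply, diffHom_apply, map_mul, map_inv, quotientAut_mk]

/-- `range N_Q = (range N).map p`. -/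
theorem range_normHom_quotientAut :
    (normHom (quotientAut σ V hV)).range = (normHom σ).range.map (QuotientGroup.mk' V) := by
  ext q
  constructor
  · rintro ⟨q', rfl⟩
    obtain ⟨b, rfl⟩ := QuotientGroup.mk'_surjective V q'
    exact ⟨normHom σ b, ⟨b, rfl⟩, (normHom_quotientAut_mk σ V hV b).symm⟩
  · rintro ⟨_, ⟨b, rfl⟩, rfl⟩
    exact ⟨QuotientGroup.mk' V b, normHom_quotientAut_mk σ V hV b⟩

/-- `range D_Q = (range D).map p`. -/
theorem range_diffHom_quotientAut :
    (diffHom (quotientAut σ V hV)).range = (diffHom σ).range.map (QuotientGroup.mk' V) := by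
  ext q
  constructor
  · rintro ⟨q', rfl⟩
    obtain ⟨b, rfl⟩ := QuotientGroup.mk'_surjective V q'
    exact ⟨diffHom σ b, ⟨b, rfl⟩, (diffHom_quotientAut_mk σ V hV b).symm⟩
  · rintro ⟨_, ⟨b, rfl⟩, rfl⟩
    exact ⟨QuotientGroup.mk' V b, diffHom_quotientAut_mk σ V hV b⟩

include hσσ in
/-- `ker D_Q = (ker D).map p` when every norm-one element of `V` is `c / σ c` with `c ∈ V`
(`Ĥ⁻¹(V) = 0`). -/
theorem ker_diffHom_quotientAut (h1 : ∀ b ∈ V, b * σ b = 1 → ∃ c ∈ V, c * (σ c)⁻¹ = b) :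
    (diffHom (quotientAut σ V hV)).ker = (diffHom σ).ker.map (QuotientGroup.mk' V) := by
  ext q
  constructor
  · intro hq
    obtain ⟨b, rfl⟩ := QuotientGroup.mk'_surjective V q
    rw [MonoidHom.mem_ker, diffHom_quotientAut_mk, ← MonoidHom.mem_ker, QuotientGroup.ker_mk'] at hq
    obtain ⟨c, hcV, hc⟩ := h1 _ hq (normHom_diffHom σ hσσ b)
    have hc1 : QuotientGroup.mk' V c = 1 := (QuotientGroup.eq_one_iff c).mpr hcV
    refine ⟨b * c⁻¹, ?_, ?_⟩
    · show b * c⁻¹ ∈ (diffHom σ).ker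
      rw [MonoidHom.mem_ker, map_mul, map_inv]
      change diffHom σ b * (diffHom σ c)⁻¹ = 1
      rw [show diffHom σ c = diffHom σ b from hc, mul_inv_cancel]
    · rw [map_mul, map_inv, hc1, inv_one, mul_one]
  · rintro ⟨b, hb, rfl⟩
    have hb' : diffHom σ b = 1 := hb
    rw [MonoidHom.mem_ker, diffHom_quotientAut_mk, hb', map_one]

include hσσ in
/-- `ker N_Q = (ker N).map p` when every `σ`-fixed element of `V` is a norm from `V`
(`Ĥ⁰(V) = 0`). -/
theorem ker_normHom_quotientAut (h0 : ∀ b ∈ V, σ b = b → ∃ c ∈ V, c * σ c = b) :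
    (normHom (quotientAut σ V hV)).ker = (normHom σ).ker.map (QuotientGroup.mk' V) := by
  ext q
  constructor
  · intro hq
    obtain ⟨b, rfl⟩ := QuotientGroup.mk'_surjective V q
    rw [MonoidHom.mem_ker, normHom_quotientAut_mk, ← MonoidHom.mem_ker, QuotientGroup.ker_mk'] at hq
    obtain ⟨c, hcV, hc⟩ := h0 _ hq (apply_normHom σ hσσ b)
    have hc1 : QuotientGroup.mk' V c = 1 := (QuotientGroup.eq_one_iff c).mpr hcV
    refine ⟨b * c⁻¹, ?_, ?_⟩
    · show b * c⁻¹ ∈ (normHom σ).ker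
      rw [MonoidHom.mem_ker, map_mul, map_inv]
      change normHom σ b * (normHom σ c)⁻¹ = 1
      rw [show normHom σ c = normHom σ b from hc, mul_inv_cancel]
    · rw [map_mul, map_inv, hc1, inv_one, mul_one]
  · rintro ⟨b, hb, rfl⟩
    have hb' : normHom σ b = 1 := hb
    rw [MonoidHom.mem_ker, normHom_quotientAut_mk, hb', map_one]

include hσσ hV in
/-- THE COMPARISON THEOREM: for a `σ`-stable subgroup `V` of finite index with `Ĥ⁰(V) = Ĥ⁻¹(V) = 0`,
`(range N).relIndex (ker D) = (range D).relIndex (ker N)` on `B`. -/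
theorem relIndex_eq_of_subgroup [V.FiniteIndex]
    (h0 : ∀ b ∈ V, σ b = b → ∃ c ∈ V, c * σ c = b)
    (h1 : ∀ b ∈ V, b * σ b = 1 → ∃ c ∈ V, c * (σ c)⁻¹ = b) :
    (normHom σ).range.relIndex (diffHom σ).ker = (diffHom σ).range.relIndex (normHom σ).ker := by
  have e0 : (normHom σ).range.relIndex (diffHom σ).ker =
      ((normHom σ).range.map (QuotientGroup.mk' V)).relIndex
        ((diffHom σ).ker.map (QuotientGroup.mk' V)) := by
    rw [relIndex_map_eq_of_inf_ker_le (QuotientGroup.mk' V) _ _ (range_normHom_le σ hσσ)]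
    rintro b ⟨hb, hbV⟩
    rw [QuotientGroup.ker_mk'] at hbV
    obtain ⟨c, -, hc⟩ := h0 b hbV ((mem_ker_diffHom σ).mp hb)
    exact ⟨c, hc⟩
  have e1 : (diffHom σ).range.relIndex (normHom σ).ker =
      ((diffHom σ).range.map (QuotientGroup.mk' V)).relIndex
        ((normHom σ).ker.map (QuotientGroup.mk' V)) := by
    rw [relIndex_map_eq_of_inf_ker_le (QuotientGroup.mk' V) _ _ (range_diffHom_le σ hσσ)]
    rintro b ⟨hb, hbV⟩
    rw [QuotientGroup.ker_mk'] at hbV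
    obtain ⟨c, -, hc⟩ := h1 b hbV ((mem_ker_normHom σ).mp hb)
    exact ⟨c, hc⟩
  rw [e0, e1, ← range_normHom_quotientAut σ V hV, ← range_diffHom_quotientAut σ V hV,
    ← ker_diffHom_quotientAut σ hσσ V hV h1, ← ker_normHom_quotientAut σ hσσ V hV h0]
  exact relIndex_eq_of_finite (quotientAut σ V hV) (quotientAut_quotientAut σ hσσ V hV)

end Quotient

section SubgroupForm

variable (U : Subgroup B) (hU : ∀ b ∈ U, σ b ∈ U)

/-- The involution restricted to a `σ`-stable subgroup `U`. -/
def restrictAut : U →* U :=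
  (σ.restrict U).codRestrict U fun u => hU u u.2

/-- The restricted involution on an element. -/
@[simp] theorem coe_restrictAut (u : U) : ((restrictAut σ U hU u : U) : B) = σ u := rfl

/-- `(range N_U).map subtype = U.map N`. -/
theorem range_normHom_restrictAut :
    (normHom (restrictAut σ U hU)).range.map U.subtype = U.map (normHom σ) := by
  ext b
  simp only [Subgroup.mem_map, MonoidHom.mem_range, Subgroup.coe_subtype]
  constructor
  · rintro ⟨_, ⟨u, rfl⟩, rfl⟩
    exact ⟨u, u.2, rfl⟩
  · rintro ⟨u, hu, rfl⟩
    exact ⟨normHom (restrictAut σ U hU) ⟨u, hu⟩, ⟨⟨u, hu⟩, rfl⟩, rfl⟩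

/-- `(range D_U).map subtype = U.map D`. -/
theorem range_diffHom_restrictAut :
    (diffHom (restrictAut σ U hU)).range.map U.subtype = U.map (diffHom σ) := by
  ext b
  simp only [Subgroup.mem_map, MonoidHom.mem_range, Subgroup.coe_subtype]
  constructor
  · rintro ⟨_, ⟨u, rfl⟩, rfl⟩
    exact ⟨u, u.2, rfl⟩
  · rintro ⟨u, hu, rfl⟩
    exact ⟨diffHom (restrictAut σ U hU) ⟨u, hu⟩, ⟨⟨u, hu⟩, rfl⟩, rfl⟩

/-- `(ker D_U).map subtype = ker D ⊓ U`. -/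
theorem ker_diffHom_restrictAut :
    (diffHom (restrictAut σ U hU)).ker.map U.subtype = (diffHom σ).ker ⊓ U := by
  ext b
  simp only [Subgroup.mem_map, Subgroup.coe_subtype, Subgroup.mem_inf]
  constructor
  · rintro ⟨u, hu, rfl⟩
    refine ⟨?_, u.2⟩
    rw [mem_ker_diffHom] at hu ⊢
    exact congrArg Subtype.val hu
  · rintro ⟨hb, hbU⟩
    refine ⟨⟨b, hbU⟩, ?_, rfl⟩
    rw [mem_ker_diffHom] at hb ⊢
    exact Subtype.ext hb

/-- `(ker N_U).map subtype = ker N ⊓ U`. -/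
theorem ker_normHom_restrictAut :
    (normHom (restrictAut σ U hU)).ker.map U.subtype = (normHom σ).ker ⊓ U := by
  ext b
  simp only [Subgroup.mem_map, Subgroup.coe_subtype, Subgroup.mem_inf]
  constructor
  · rintro ⟨u, hu, rfl⟩
    refine ⟨?_, u.2⟩
    rw [mem_ker_normHom] at hu ⊢
    exact congrArg Subtype.val hu
  · rintro ⟨hb, hbU⟩
    refine ⟨⟨b, hbU⟩, ?_, rfl⟩
    rw [mem_ker_normHom] at hb ⊢
    exact Subtype.ext hb

include hσσ hU in
/-- THE COMPARISON THEOREM ON A SUBGROUP `U`: if `V ≤ U` is `σ`-stable, of finite index in `U`,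
with `Ĥ⁰(V) = Ĥ⁻¹(V) = 0`, then `[U^σ : N U] = [ker N ∩ U : D U]`. -/
theorem relIndex_eq_of_subgroup_of_le (V : Subgroup B) (hVU : V ≤ U) (hV : ∀ b ∈ V, σ b ∈ V)
    [(V.subgroupOf U).FiniteIndex]
    (h0 : ∀ b ∈ V, σ b = b → ∃ c ∈ V, c * σ c = b)
    (h1 : ∀ b ∈ V, b * σ b = 1 → ∃ c ∈ V, c * (σ c)⁻¹ = b) :
    (U.map (normHom σ)).relIndex ((diffHom σ).ker ⊓ U) =
      (U.map (diffHom σ)).relIndex ((normHom σ).ker ⊓ U) := by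
  rw [← range_normHom_restrictAut σ U hU, ← ker_diffHom_restrictAut σ U hU,
    ← range_diffHom_restrictAut σ U hU, ← ker_normHom_restrictAut σ U hU,
    Subgroup.relIndex_map_map_of_injective _ _ U.subtype_injective,
    Subgroup.relIndex_map_map_of_injective _ _ U.subtype_injective]
  apply relIndex_eq_of_subgroup (restrictAut σ U hU) (fun u => Subtype.ext (hσσ u)) (V.subgroupOf U)
  · intro u hu
    exact hV u hu
  · rintro ⟨b, hbU⟩ hb hfix
    obtain ⟨c, hcV, hc⟩ := h0 b hb (congrArg Subtype.val hfix)
    exact ⟨⟨c, hVU hcV⟩, hcV, Subtype.ext hc⟩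
  · rintro ⟨b, hbU⟩ hb hnorm
    obtain ⟨c, hcV, hc⟩ := h1 b hb (congrArg Subtype.val hnorm)
    exact ⟨⟨c, hVU hcV⟩, hcV, Subtype.ext hc⟩

end SubgroupForm

end Summit.Ventures.HodgeRepro2.T5TateComparison
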